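import Summits.CriticalPhenomena.PercolationContinuityZ3.Theorems.PercNearOneGluingNoHeavyLowerTailIncStarOneTargetSideMoments
import Summits.CriticalPhenomena.PercolationContinuityZ3.Theorems.PercNearOneGluingNoHeavyLowerTailIncStarOneTargetSideReal
import HarnessLib

/-!
# One-target sides of two-separations (root outside), IV: THEOREM G′

Support file for the Sahi programme (`--supports stmt-CriticalPhenomena-4575`, prover prim-sahi-p2 gen 24).  No definitions, no named
facts, no sorries; standard axioms.  Memo `run/shared/lean/prim/prim-sahi/FROM-prim-sahi-p2-gen24-ONE-TARGET-SIDE.md` §1.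

**THEOREM G′ (one-target side of a two-separation not containing the root).**  Product Bernoulli bond percolation `prodBernoulli w` on
`Fin n`; a root side `R ∋ s` and separating vertices `u, v ∉ R` with no positive pair from `R` to the outside of `R ∪ {u, v}`; a target
`a ∉ R` (anywhere outside the root side) and targets `b, c ∈ R ∪ {u, v}`.  Then

  `STAR(w; u, b, c) ∧ STAR(w; v, b, c) ∧ STAR(w[s(u,v) ↦ 1]; u, b, c)  ⟹  STAR(w; a, b, c)`,

`STAR(w; t, b, c) := 0 ≤ E₃({s↔t},{s↔b},{s↔c})` (`incStar_nonneg_of_oneTargetSide`): a target inside a one-target side of a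
two-separation `{u, v}` with the root outside may be MOVED ONTO THE SEPARATOR (and the side then becomes markless: gen 11's blob), at
the price of one extra instance with the pair `(u, v)` made sure.  Inputs: the moments (M1), (M2) of `…OneTargetSideMoments`, Harris
twice (near: `{a ↔ {u,v}}` vs `{u ↔ v}`; far: `{s ~ {u,v}}` vs `B¹`), and the real core `…OneTargetSideReal` (three-ray identity; for the
ray "a ≡ u ≡ v", which is not realisable, `Φ_Z` is compared with the star of `w[s(u,v) ↦ 1]`).  Together with THEOREM G (gen 23,
separator `{s, x}`) every two-separation of a minimal counterexample with exactly one target strictly inside one side is reducible.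
-/

noncomputable section

namespace Summit.CriticalPhenomena.PercolationContinuityZ3.Theorems

namespace IncStarOneTargetSide

open MeasureTheory Set Literature.Probability.Percolation Literature.Probability.LatticeModels
open scoped Classical

variable {n : ℕ}

set_option maxHeartbeats 400000 in
/-- **THEOREM G′ (one-target side of a two-separation not containing the root).**  Let `s ∈ R`, `u, v ∉ R`, no positive pair from
`R` to the outside of `R ∪ {u, v}`, `a ∉ R`, `b, c ∈ R ∪ {u, v}`.  If the increasing star holds at `(u, b, c)` and at `(v, b, c)` under
`prodBernoulli w`, and at `(u, b, c)` under `prodBernoulli (w[s(u,v) ↦ 1])`, then it holds at `(a, b, c)` under `prodBernoulli w`: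
`0 ≤ E₃({s↔a},{s↔b},{s↔c})`. [this work] -/
theorem incStar_nonneg_of_oneTargetSide (w : Sym2 (Fin n) → unitInterval) (R : Set (Fin n)) {s u v a b c : Fin n}
    (hs : s ∈ R) (hu : u ∉ R) (hv : v ∉ R) (ha : a ∉ R) (hb : b ∈ R ∨ b = u ∨ b = v) (hc : c ∈ R ∨ c = u ∨ c = v)
    (hw : ∀ x ∈ R, ∀ z, z ∉ R → z ≠ u → z ≠ v → w s(x, z) = 0)
    (hU : 0 ≤ sahiE3 (prodBernoulli w) (openConn s u) (openConn s b) (openConn s c))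
    (hV : 0 ≤ sahiE3 (prodBernoulli w) (openConn s v) (openConn s b) (openConn s c))
    (h1 : 0 ≤ sahiE3 (prodBernoulli (Function.update w s(u, v) 1)) (openConn s u) (openConn s b) (openConn s c)) :
    0 ≤ sahiE3 (prodBernoulli w) (openConn s a) (openConn s b) (openConn s c) := by
  have hmeas : ∀ X : Set (BondConfig (Fin n)), MeasurableSet X := fun _ => MeasurableSet.of_discrete
  -- events (opaque names with defining equations: keeps the terms small)
  obtain ⟨F, hFd⟩ : ∃ S : Set (Sym2 (Fin n)), S = {e : Sym2 (Fin n) | ∃ y ∈ R, y ∈ e} := ⟨_, rfl⟩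
  obtain ⟨Xu, hXud⟩ : ∃ S : Set (BondConfig (Fin n)), S = {ω | ω ∩ F ∈ (openConn s u : Set (BondConfig (Fin n)))} := ⟨_, rfl⟩
  obtain ⟨Xv, hXvd⟩ : ∃ S : Set (BondConfig (Fin n)), S = {ω | ω ∩ F ∈ (openConn s v : Set (BondConfig (Fin n)))} := ⟨_, rfl⟩
  obtain ⟨Bb, hBbd⟩ : ∃ S : Set (BondConfig (Fin n)), S = {ω | ω ∩ F ∈ (openConn s b : Set (BondConfig (Fin n)))} := ⟨_, rfl⟩
  obtain ⟨Bc, hBcd⟩ : ∃ S : Set (BondConfig (Fin n)), S = {ω | ω ∩ F ∈ (openConn s c : Set (BondConfig (Fin n)))} := ⟨_, rfl⟩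
  obtain ⟨Vb, hVbd⟩ : ∃ S : Set (BondConfig (Fin n)), S = {ω | ω ∩ F ∈ (openConn v b : Set (BondConfig (Fin n)))} := ⟨_, rfl⟩
  obtain ⟨Ub, hUbd⟩ : ∃ S : Set (BondConfig (Fin n)), S = {ω | ω ∩ F ∈ (openConn u b : Set (BondConfig (Fin n)))} := ⟨_, rfl⟩
  obtain ⟨Vc, hVcd⟩ : ∃ S : Set (BondConfig (Fin n)), S = {ω | ω ∩ F ∈ (openConn v c : Set (BondConfig (Fin n)))} := ⟨_, rfl⟩
  obtain ⟨Uc, hUcd⟩ : ∃ S : Set (BondConfig (Fin n)), S = {ω | ω ∩ F ∈ (openConn u c : Set (BondConfig (Fin n)))} := ⟨_, rfl⟩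
  obtain ⟨B1b, hB1bd⟩ : ∃ S : Set (BondConfig (Fin n)), S = Bb ∪ ((Xu ∩ Vb) ∪ (Xv ∩ Ub)) := ⟨_, rfl⟩
  obtain ⟨B1c, hB1cd⟩ : ∃ S : Set (BondConfig (Fin n)), S = Bc ∪ ((Xu ∩ Vc) ∪ (Xv ∩ Uc)) := ⟨_, rfl⟩
  have hB1bd' : B1b = Bb ∪ ((Xu ∩ {ω | ω ∩ F ∈ (openConn v b : Set (BondConfig (Fin n)))})
      ∪ (Xv ∩ {ω | ω ∩ F ∈ (openConn u b : Set (BondConfig (Fin n)))})) := by rw [hB1bd, hVbd, hUbd]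
  have hB1cd' : B1c = Bc ∪ ((Xu ∩ {ω | ω ∩ F ∈ (openConn v c : Set (BondConfig (Fin n)))})
      ∪ (Xv ∩ {ω | ω ∩ F ∈ (openConn u c : Set (BondConfig (Fin n)))})) := by rw [hB1cd, hVcd, hUcd]
  -- reals
  obtain ⟨ζ, hζ⟩ : ∃ r : ℝ, r = (prodBernoulli w).real (openConnIn Rᶜ u v) := ⟨_, rfl⟩
  obtain ⟨vu, hvu⟩ : ∃ r : ℝ, r = (prodBernoulli w).real (openConnIn Rᶜ u a \ openConnIn Rᶜ v a) := ⟨_, rfl⟩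
  obtain ⟨vv, hvv⟩ : ∃ r : ℝ, r = (prodBernoulli w).real (openConnIn Rᶜ v a \ openConnIn Rᶜ u a) := ⟨_, rfl⟩
  obtain ⟨vZ, hvZ⟩ : ∃ r : ℝ, r = (prodBernoulli w).real (openConnIn Rᶜ u a ∩ openConnIn Rᶜ v a) := ⟨_, rfl⟩
  obtain ⟨xu, hxu⟩ : ∃ r : ℝ, r = (prodBernoulli w).real Xu := ⟨_, rfl⟩
  obtain ⟨xv, hxv⟩ : ∃ r : ℝ, r = (prodBernoulli w).real Xv := ⟨_, rfl⟩
  obtain ⟨ρ, hρ⟩ : ∃ r : ℝ, r = (prodBernoulli w).real (Xu ∪ Xv) := ⟨_, rfl⟩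
  obtain ⟨β, hβ⟩ : ∃ r : ℝ, r = (prodBernoulli w).real Bb := ⟨_, rfl⟩
  obtain ⟨γ, hγ⟩ : ∃ r : ℝ, r = (prodBernoulli w).real Bc := ⟨_, rfl⟩
  obtain ⟨m, hm⟩ : ∃ r : ℝ, r = (prodBernoulli w).real (Bb ∩ Bc) := ⟨_, rfl⟩
  obtain ⟨β₁, hβ₁⟩ : ∃ r : ℝ, r = (prodBernoulli w).real B1b := ⟨_, rfl⟩
  obtain ⟨γ₁, hγ₁⟩ : ∃ r : ℝ, r = (prodBernoulli w).real B1c := ⟨_, rfl⟩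
  obtain ⟨m₁, hm₁⟩ : ∃ r : ℝ, r = (prodBernoulli w).real (B1b ∩ B1c) := ⟨_, rfl⟩
  obtain ⟨pub, hpub⟩ : ∃ r : ℝ, r = (prodBernoulli w).real (Xu ∩ Bb) := ⟨_, rfl⟩
  obtain ⟨puc, hpuc⟩ : ∃ r : ℝ, r = (prodBernoulli w).real (Xu ∩ Bc) := ⟨_, rfl⟩
  obtain ⟨pubc, hpubc⟩ : ∃ r : ℝ, r = (prodBernoulli w).real (Xu ∩ (Bb ∩ Bc)) := ⟨_, rfl⟩
  obtain ⟨pvb, hpvb⟩ : ∃ r : ℝ, r = (prodBernoulli w).real (Xv ∩ Bb) := ⟨_, rfl⟩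
  obtain ⟨pvc, hpvc⟩ : ∃ r : ℝ, r = (prodBernoulli w).real (Xv ∩ Bc) := ⟨_, rfl⟩
  obtain ⟨pvbc, hpvbc⟩ : ∃ r : ℝ, r = (prodBernoulli w).real (Xv ∩ (Bb ∩ Bc)) := ⟨_, rfl⟩
  obtain ⟨rb, hrb⟩ : ∃ r : ℝ, r = (prodBernoulli w).real ((Xu ∪ Xv) ∩ B1b) := ⟨_, rfl⟩
  obtain ⟨rc, hrc⟩ : ∃ r : ℝ, r = (prodBernoulli w).real ((Xu ∪ Xv) ∩ B1c) := ⟨_, rfl⟩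
  obtain ⟨rbc, hrbc⟩ : ∃ r : ℝ, r = (prodBernoulli w).real ((Xu ∪ Xv) ∩ (B1b ∩ B1c)) := ⟨_, rfl⟩
  -- (M1) and (M2) at the port `u`
  have e1 := oneTargetSide_sahiE3_eq w R hs ha hb hc hw hFd hXud hXvd hBbd hBcd hB1bd' hB1cd'
    hζ hvu hvv hvZ hxu hxv hρ hβ hγ hm hβ₁ hγ₁ hm₁ hpub hpuc hpubc hpvb hpvc hpvbc hrb hrc hrbc
  have e2 := oneTargetSide_sahiE3_port_eq w R hs hu hb hc hw hFd hXud hXvd hBbd hBcd hB1bd' hB1cd'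
    hζ hxu hρ hβ hγ hm hβ₁ hγ₁ hm₁ hpub hpuc hpubc hrb hrc hrbc
  -- (M2) at the port `v` (exchange `u` and `v`)
  have hb' : b ∈ R ∨ b = v ∨ b = u := by rcases hb with h | h | h; exacts [Or.inl h, Or.inr (Or.inr h), Or.inr (Or.inl h)]
  have hc' : c ∈ R ∨ c = v ∨ c = u := by rcases hc with h | h | h; exacts [Or.inl h, Or.inr (Or.inr h), Or.inr (Or.inl h)]
  have hw' : ∀ x ∈ R, ∀ z, z ∉ R → z ≠ v → z ≠ u → w s(x, z) = 0 := fun x hx z hz hzv hzu => hw x hx z hz hzu hzv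
  have hB1b' : B1b = Bb ∪ ((Xv ∩ {ω | ω ∩ F ∈ (openConn u b : Set (BondConfig (Fin n)))})
      ∪ (Xu ∩ {ω | ω ∩ F ∈ (openConn v b : Set (BondConfig (Fin n)))})) := by rw [hB1bd, hVbd, hUbd, Set.union_comm (Xu ∩ _)]
  have hB1c' : B1c = Bc ∪ ((Xv ∩ {ω | ω ∩ F ∈ (openConn u c : Set (BondConfig (Fin n)))})
      ∪ (Xu ∩ {ω | ω ∩ F ∈ (openConn v c : Set (BondConfig (Fin n)))})) := by rw [hB1cd, hVcd, hUcd, Set.union_comm (Xu ∩ _)]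
  have hζ' : ζ = (prodBernoulli w).real (openConnIn Rᶜ v u) := by rw [hζ, openConnIn_comm]
  have hρ' : ρ = (prodBernoulli w).real (Xv ∪ Xu) := by rw [hρ, Set.union_comm]
  have hrb' : rb = (prodBernoulli w).real ((Xv ∪ Xu) ∩ B1b) := by rw [hrb, Set.union_comm]
  have hrc' : rc = (prodBernoulli w).real ((Xv ∪ Xu) ∩ B1c) := by rw [hrc, Set.union_comm]
  have hrbc' : rbc = (prodBernoulli w).real ((Xv ∪ Xu) ∩ (B1b ∩ B1c)) := by rw [hrbc, Set.union_comm]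
  have e3 := oneTargetSide_sahiE3_port_eq w R hs hv hb' hc' hw' hFd hXvd hXud hBbd hBcd hB1b' hB1c'
    hζ' hxv hρ' hβ hγ hm hβ₁ hγ₁ hm₁ hpvb hpvc hpvbc hrb' hrc' hrbc'
  -- (M2) at the port `u` for the weight with the pair `(u, v)` made sure
  obtain ⟨w₁, hw₁d⟩ : ∃ w' : Sym2 (Fin n) → unitInterval, w' = Function.update w s(u, v) 1 := ⟨_, rfl⟩
  rw [← hw₁d] at h1
  have huvF : s(u, v) ∉ F := by
    rw [hFd]; intro h
    have h' : ∃ y ∈ R, y ∈ s(u, v) := h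
    obtain ⟨y, hyR, hy⟩ := h'
    rcases Sym2.mem_iff.1 hy with rfl | rfl
    · exact hu hyR
    · exact hv hyR
  have hagree : ∀ e ∈ F, w₁ e = w e := fun e he => by
    rw [hw₁d, Function.update_of_ne]
    rintro rfl; exact huvF he
  have hw₁ : ∀ x ∈ R, ∀ z, z ∉ R → z ≠ u → z ≠ v → w₁ s(x, z) = 0 := by
    intro x hx z hz hzu hzv
    have hmem : s(x, z) ∈ F := by rw [hFd]; exact ⟨x, hx, Sym2.mem_mk_left x z⟩
    rw [hagree _ hmem]
    exact hw x hx z hz hzu hzv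
  have dF : ∀ p q : Fin n, DeterminedBy {ω : BondConfig (Fin n) | ω ∩ F ∈ (openConn p q : Set (BondConfig (Fin n)))} F := by
    intro p q; rw [hFd]; exact SahiRootSide.determinedBy_rootSide R p q
  have dXu : DeterminedBy Xu F := by rw [hXud]; exact dF s u
  have dXv : DeterminedBy Xv F := by rw [hXvd]; exact dF s v
  have dXuv : DeterminedBy (Xu ∪ Xv) F := (determinedBy_union_sdiff dXu dXv).1
  have dBb : DeterminedBy Bb F := by rw [hBbd]; exact dF s b
  have dBc : DeterminedBy Bc F := by rw [hBcd]; exact dF s c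
  have dVb : DeterminedBy Vb F := by rw [hVbd]; exact dF v b
  have dUb : DeterminedBy Ub F := by rw [hUbd]; exact dF u b
  have dVc : DeterminedBy Vc F := by rw [hVcd]; exact dF v c
  have dUc : DeterminedBy Uc F := by rw [hUcd]; exact dF u c
  have dB1b : DeterminedBy B1b F := by
    rw [hB1bd]; exact (determinedBy_union_sdiff dBb (determinedBy_union_sdiff (dXu.inter dVb) (dXv.inter dUb)).1).1
  have dB1c : DeterminedBy B1c F := by
    rw [hB1cd]; exact (determinedBy_union_sdiff dBc (determinedBy_union_sdiff (dXu.inter dVc) (dXv.inter dUc)).1).1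
  have far : ∀ {E : Set (BondConfig (Fin n))} {r : ℝ}, DeterminedBy E F → r = (prodBernoulli w).real E →
      r = (prodBernoulli w₁).real E := by
    intro E r hE hr
    rw [hr]; exact (prodBernoulli_real_eq_of_determinedBy w₁ w hagree hE (hmeas E)).symm
  -- `ζ₁ = 1`
  have hζ₁ : (1 : ℝ) = (prodBernoulli w₁).real (openConnIn Rᶜ u v) := by
    refine le_antisymm ?_ measureReal_le_one
    have hsub : {ω : BondConfig (Fin n) | ∀ e, w₁ e = 1 → e ∈ ω} ⊆ openConnIn Rᶜ u v := by
      intro ω hω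
      by_cases huv : u = v
      · subst huv; exact openConnIn_refl hu
      · exact openConnIn_of_adj hu hv (hω _ (by rw [hw₁d, Function.update_self])) huv
    calc (1 : ℝ) = (prodBernoulli w₁).real {ω : BondConfig (Fin n) | ∀ e, w₁ e = 1 → e ∈ ω} := (IncStar.real_sureOpen w₁).symm
      _ ≤ (prodBernoulli w₁).real (openConnIn Rᶜ u v) := measureReal_mono hsub
  have e4 := oneTargetSide_sahiE3_port_eq w₁ R hs hu hb hc hw₁ hFd hXud hXvd hBbd hBcd hB1bd' hB1cd'
    hζ₁ (far dXu hxu) (far dXuv hρ) (far dBb hβ) (far dBc hγ) (far (dBb.inter dBc) hm) (far dB1b hβ₁) (far dB1c hγ₁)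
    (far (dB1b.inter dB1c) hm₁) (far (dXu.inter dBb) hpub) (far (dXu.inter dBc) hpuc) (far (dXu.inter (dBb.inter dBc)) hpubc)
    (far (dXuv.inter dB1b) hrb) (far (dXuv.inter dB1c) hrc) (far (dXuv.inter (dB1b.inter dB1c)) hrbc)
  have hstar1 : 0 ≤ 2 * rbc - rb * γ₁ - rc * β₁ - m₁ * ρ + ρ * β₁ * γ₁ := by
    have key : ∀ A : ℝ, (1 - (1 : ℝ)) * A
        + 1 * (2 * rbc - rb * ((1 - 1) * γ + 1 * γ₁) - rc * ((1 - 1) * β + 1 * β₁) - ((1 - 1) * m + 1 * m₁) * ρ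
              + ρ * ((1 - 1) * β + 1 * β₁) * ((1 - 1) * γ + 1 * γ₁))
        = 2 * rbc - rb * γ₁ - rc * β₁ - m₁ * ρ + ρ * β₁ * γ₁ := fun A => by ring
    have h := h1
    rw [e4, key] at h
    exact h
  -- Harris inputs and ranges
  have hζ1 : ζ ≤ 1 := by rw [hζ]; exact measureReal_le_one
  have hρ0 : 0 ≤ ρ := by rw [hρ]; exact measureReal_nonneg
  have hvu0 : 0 ≤ vu := by rw [hvu]; exact measureReal_nonneg
  have hvv0 : 0 ≤ vv := by rw [hvv]; exact measureReal_nonneg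
  have hvZ0 : 0 ≤ vZ := by rw [hvZ]; exact measureReal_nonneg
  have sB : Bb ⊆ B1b := by rw [hB1bd]; exact Set.subset_union_left
  have sC : Bc ⊆ B1c := by rw [hB1cd]; exact Set.subset_union_left
  have hββ₁ : β ≤ β₁ := by rw [hβ, hβ₁]; exact measureReal_mono sB
  have hγγ₁ : γ ≤ γ₁ := by rw [hγ, hγ₁]; exact measureReal_mono sC
  have hmm₁ : m ≤ m₁ := by rw [hm, hm₁]; exact measureReal_mono (Set.inter_subset_inter sB sC)
  have upF : ∀ p q : Fin n, IsUpperSet {ω : BondConfig (Fin n) | ω ∩ F ∈ (openConn p q : Set (BondConfig (Fin n)))} :=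
    fun p q => isUpperSet_connF F p q
  have upXu : IsUpperSet Xu := by rw [hXud]; exact upF s u
  have upXv : IsUpperSet Xv := by rw [hXvd]; exact upF s v
  have upB1b : IsUpperSet B1b := by
    rw [hB1bd, hBbd, hVbd, hUbd]; exact (upF s b).union ((upXu.inter (upF v b)).union (upXv.inter (upF u b)))
  have upB1c : IsUpperSet B1c := by
    rw [hB1cd, hBcd, hVcd, hUcd]; exact (upF s c).union ((upXu.inter (upF v c)).union (upXv.inter (upF u c)))
  have hrbH : ρ * β₁ ≤ rb := by
    have h := far_harris w F s u v upB1b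
    rw [← hXud, ← hXvd] at h
    rw [hρ, hβ₁, hrb]; exact h
  have hrcH : ρ * γ₁ ≤ rc := by
    have h := far_harris w F s u v upB1c
    rw [← hXud, ← hXvd] at h
    rw [hρ, hγ₁, hrc]; exact h
  have hh : ζ * (vu + vv + vZ) ≤ vZ := by rw [hζ, hvu, hvv, hvZ]; exact near_harris w Rᶜ u v a
  -- the real core
  have hΦZ := oneTargetSide_phiZ_nonneg (ζ := ζ) hζ1 hρ0 hββ₁ hγγ₁ hmm₁ hrbH hrcH hstar1
  have hU' := hU
  rw [e2] at hU'
  have hV' := hV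
  rw [e3] at hV'
  rw [e1]
  exact oneTargetSide_threeRay_nonneg hζ1 hvu0 hvv0 hvZ0 hh hΦZ hU' hV'

end IncStarOneTargetSide

end Summit.CriticalPhenomena.PercolationContinuityZ3.Theorems
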